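import Summits.Ventures.YMGap.Census.InterpolationAlpha
import Summits.Ventures.YMGap.Census.DecimationTwistPlus
import HarnessLib

/-!
# Venture YMGap, track (b) census — the interpolation parameter `α⁺_Λ(t, r)` of the `Z⁺` decimation EXISTS
# (arXiv:0707.2179, §4.2 eqs. (4.14)–(4.19); Prop. IV.5 in weak form)

HONEST FRAMING: venture file of the cell `pub-ymgap` (QuantumFields programme), track (b) census.  Exact statements about one decimation
`(ℤ/bLℤ)^d → (ℤ/Lℤ)^d`, `L ≥ 2` even, `d ≥ 3`, twist on `𝒱_{ij}` on both tori, positivity domain `f_c ≥ 0`; nothing about (5.14)–(5.16)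
(a COMMON `α` for `Z` and `Z⁺` — Ito–Seiler's Problem 2, the tree's `ISProblem2` — is NOT touched), confinement or any limit.

The `Z⁺` twin of `InterpolationAlpha`: `Z̃⁺(α, t) = F₀^U^{h(α,t)|Λ^{(1)}|} Z⁺_{Λ^{(1)}}({α c^U_j(r)})` (the tree's `tildeZplus`) is
non-decreasing in `α ∈ (0,1]` (`tildeZplus_monotoneOn`, IV.5 weak form, via IV.2 (i) `torusZplus_mono`), tends to `1` as `α ↓ 0`
(`tendsto_tildeZplus_zero`), and — IV.3 at `α = 1` (`decimationUpperBoundPlus_of_nonneg_of_le_one`) — the defining relation (4.18)–(4.19)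
`Z̃⁺(α, t) = Z⁺_Λ` has a solution `α ∈ (0, 1]` whenever `Z⁺_Λ > 1` (`exists_alphaPlus_Ioc`); `IsAlphaPlus` (open interval) follows from a
strict IV.3 instance (`exists_isAlphaPlus_of_lt`).
[cite: Tomboulis2007Confinement, §4.2 eqs. (4.14)–(4.19), Prop. IV.5] [cite: ItoSeiler2007Tomboulis, §3 eq. (3.1b)]
-/

noncomputable section

open MeasureTheory Finset Real Filter Topology
open scoped BigOperators
open Literature.MathematicalPhysics.QuantumLattice
open Literature.MathematicalPhysics.QuantumFieldTheory
open Literature.MathematicalPhysics.QuantumFieldTheory.Tomboulis2007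

namespace Summit.Ventures.YMGap.Census

variable {d L b : ℕ} [NeZero b] [NeZero L]

omit [NeZero b] in
/-- `α ↦ Z⁺_Λ({α c}; V)` is continuous. -/
theorem continuous_torusZplus_scaleCoeff (J : ℕ) (c : ℕ → ℝ) (V : Finset (Plaquette d L)) :
    Continuous fun α : ℝ => torusZplus d L J (scaleCoeff α c) V := by
  unfold torusZplus
  exact ((continuous_torusZ_scaleCoeff J c).add (continuous_torusZtw_scaleCoeff J c V)).div_const _

omit [NeZero b] in
/-- `Z⁺_Λ({0}; V) = 1`. -/
theorem torusZplus_scaleCoeff_zero (J : ℕ) (c : ℕ → ℝ) (V : Finset (Plaquette d L)) : torusZplus d L J (scaleCoeff 0 c) V = 1 := by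
  unfold torusZplus
  rw [torusZ_scaleCoeff_zero, torusZtw_scaleCoeff_zero]
  norm_num

omit [NeZero b] in
/-- `Z̃⁺(1, t) = F₀^U(1)^{|Λ^{(1)}|} Z⁺_{Λ^{(1)}}({c^U_j(1,r)})` — the right-hand side of IV.3 (4.12). -/
theorem tildeZplus_one (J : ℕ) (r : ℝ) {i j : Fin d} (hij : i < j) (c : ℕ → ℝ) (t : ℝ) :
    tildeZplus L b J r i j hij c 1 t =
      mkF0 J c (b ^ (d - 2)) b ^ Fintype.card (Plaquette d L) * torusZplus d L (b ^ (d - 2) * J) (mkCoeff J c (b ^ (d - 2)) b r) (vortexSheet L i j hij) := by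
  unfold tildeZplus
  rw [interpH_one, one_mul, Real.rpow_natCast, scaleCoeff_one]

omit [NeZero b] in
/-- **Prop. IV.5, weak form (arXiv:0707.2179): `α ↦ Z̃⁺(α, t)` is non-decreasing on `(0, 1]`** (even coarse torus, `d ≥ 3`, `t ≥ 0`, `0 ≤ r`,
positivity domain). -/
theorem tildeZplus_monotoneOn (hd : 3 ≤ d) (hL : Even L) (J : ℕ) {i j : Fin d} (hij : i < j) {c : ℕ → ℝ} (hc : ∀ n, 1 ≤ n → 0 ≤ c n)
    (hf : ∀ g : SU2, 0 ≤ plaqFn J c g) {r : ℝ} (hr : 0 ≤ r) {t : ℝ} (ht : 0 ≤ t) :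
    MonotoneOn (fun α => tildeZplus L b J r i j hij c α t) (Set.Ioc 0 1) := by
  intro α hα α' hα' hαα'
  have hadm := coeffAdmissible_mkCoeff_of_nonneg (b := b) J hc hf (b ^ (d - 2)) hr
  have hF : 1 ≤ mkF0 J c (b ^ (d - 2)) b := one_le_mkF0 hc _ b
  unfold tildeZplus
  refine mul_le_mul ?_ ?_ ?_ ?_
  · exact Real.rpow_le_rpow_of_exponent_le hF (mul_le_mul_of_nonneg_right (interpH_mono ht hα.1 hαα') (Nat.cast_nonneg _))
  · exact torusZplus_mono hL _ hij (coeffAdmissible_scaleCoeff hadm ⟨hα.1.le, hα.2⟩) (coeffAdmissible_scaleCoeff hadm ⟨hα'.1.le, hα'.2⟩)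
      fun n => by
        unfold scaleCoeff
        by_cases hn : 1 ≤ n
        · exact mul_le_mul_of_nonneg_right hαα' (hadm n hn).1
        · have h0 : n = 0 := by omega
          subst h0
          have : mkCoeff J c (b ^ (d - 2)) b r 0 = 1 := by
            rw [mkCoeff_eq_rpow]
            unfold hatCoeff
            rw [div_self (mkFhat_zero_pos hc _).ne', Real.one_rpow]
          rw [this, mul_one, mul_one]
          exact hαα'
  · exact zero_le_one.trans (one_le_torusZplus hd hL _ hij (coeffAdmissible_scaleCoeff hadm ⟨hα.1.le, hα.2⟩))
  · exact Real.rpow_nonneg (zero_le_one.trans hF) _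

omit [NeZero b] in
/-- `α ↦ Z̃⁺(α, t)` is continuous away from `α = 0`. -/
theorem continuousAt_tildeZplus (J : ℕ) (r : ℝ) {i j : Fin d} (hij : i < j) {c : ℕ → ℝ} (hc : ∀ n, 1 ≤ n → 0 ≤ c n) (t : ℝ) {α : ℝ}
    (hα : α ≠ 0) : ContinuousAt (fun a => tildeZplus L b J r i j hij c a t) α := by
  unfold tildeZplus
  have hF : mkF0 J c (b ^ (d - 2)) b ≠ 0 := (zero_lt_one.trans_le (one_le_mkF0 hc _ b)).ne'
  refine ContinuousAt.mul ?_ ((continuous_torusZplus_scaleCoeff _ _ _).continuousAt)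
  exact (Real.continuousAt_const_rpow hF).comp ((continuousAt_interpH t hα).mul continuousAt_const)

omit [NeZero b] in
/-- **`Z̃⁺(α, t) → 1` as `α ↓ 0`** (`t > 0`). -/
theorem tendsto_tildeZplus_zero (J : ℕ) (r : ℝ) {i j : Fin d} (hij : i < j) {c : ℕ → ℝ} (hc : ∀ n, 1 ≤ n → 0 ≤ c n) {t : ℝ} (ht : 0 < t) :
    Tendsto (fun a => tildeZplus L b J r i j hij c a t) (𝓝[>] 0) (𝓝 1) := by
  unfold tildeZplus
  have hF : mkF0 J c (b ^ (d - 2)) b ≠ 0 := (zero_lt_one.trans_le (one_le_mkF0 hc _ b)).ne'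
  have h1 : Tendsto (fun a => mkF0 J c (b ^ (d - 2)) b ^ (interpH a t * (Fintype.card (Plaquette d L) : ℝ))) (𝓝[>] 0) (𝓝 1) := by
    have he : Tendsto (fun a => interpH a t * (Fintype.card (Plaquette d L) : ℝ)) (𝓝[>] 0) (𝓝 0) := by
      simpa using (tendsto_interpH_zero ht).mul_const (Fintype.card (Plaquette d L) : ℝ)
    have h := ((Real.continuousAt_const_rpow hF).tendsto).comp he
    rwa [Real.rpow_zero] at h
  have h2 : Tendsto (fun a : ℝ => torusZplus d L (b ^ (d - 2) * J) (scaleCoeff a (mkCoeff J c (b ^ (d - 2)) b r)) (vortexSheet L i j hij))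
      (𝓝[>] 0) (𝓝 1) := by
    have h := ((continuous_torusZplus_scaleCoeff (d := d) (L := L) (b ^ (d - 2) * J) (mkCoeff J c (b ^ (d - 2)) b r)
      (vortexSheet L i j hij)).tendsto 0).mono_left (nhdsWithin_le_nhds (s := Set.Ioi (0 : ℝ)))
    rwa [torusZplus_scaleCoeff_zero] at h
  simpa using h1.mul h2

/-- **Existence of `α⁺_Λ(t, r)` (arXiv:0707.2179 (4.18)–(4.19), first step) up to the endpoint**: on an even coarse torus of side
`L ≥ 2` (any plane `i < j`, so `d ≥ 2`), for admissible `c` with `f_c ≥ 0` and `Z⁺_{(ℤ/bL)^d}({c_j}) > 1`, every `0 ≤ r ≤ 1` and `t > 0`, there is `α ∈ (0, 1]`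
with `Z̃⁺(α, t) = Z⁺_{(ℤ/bL)^d}({c_j})`. -/
theorem exists_alphaPlus_Ioc (hL : Even L) (J : ℕ) {i j : Fin d} (hij : i < j) {c : ℕ → ℝ} (hc : CoeffAdmissible c)
    (hf : ∀ g : SU2, 0 ≤ plaqFn J c g) (hZ : 1 < torusZplus d (b * L) J c (vortexSheet (b * L) i j hij)) {r : ℝ} (hr0 : 0 ≤ r)
    (hr1 : r ≤ 1) {t : ℝ} (ht : 0 < t) :
    ∃ α ∈ Set.Ioc (0 : ℝ) 1, tildeZplus L b J r i j hij c α t = torusZplus d (b * L) J c (vortexSheet (b * L) i j hij) := by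
  haveI : Fact (1 < L) := ⟨by obtain ⟨k, hk⟩ := hL; have := NeZero.ne L; omega⟩
  have hc' : ∀ n, 1 ≤ n → 0 ≤ c n := fun n hn => (hc n hn).1
  have hev : ∀ᶠ a in 𝓝[>] (0 : ℝ), tildeZplus L b J r i j hij c a t < torusZplus d (b * L) J c (vortexSheet (b * L) i j hij) ∧
      a ∈ Set.Ioo (0 : ℝ) 1 := by
    filter_upwards [(tendsto_tildeZplus_zero (d := d) (L := L) (b := b) J r hij hc' ht).eventually (gt_mem_nhds hZ),
      Ioo_mem_nhdsGT_of_mem (show (0 : ℝ) ∈ Set.Ico (0 : ℝ) 1 from ⟨le_rfl, zero_lt_one⟩)] with a ha hb using ⟨ha, hb⟩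
  obtain ⟨a₀, ha₀lt, ha₀⟩ := hev.exists
  have h1 : torusZplus d (b * L) J c (vortexSheet (b * L) i j hij) ≤ tildeZplus L b J r i j hij c 1 t := by
    rw [tildeZplus_one]
    exact decimationUpperBoundPlus_of_nonneg_of_le_one hL hij J hc hf hr0 hr1
  have hcont : ContinuousOn (fun a => tildeZplus L b J r i j hij c a t) (Set.Icc a₀ 1) := fun a ha =>
    (continuousAt_tildeZplus J r hij hc' t (ha₀.1.trans_le ha.1).ne').continuousWithinAt
  obtain ⟨α, hα, hαeq⟩ := intermediate_value_Icc ha₀.2.le hcont ⟨ha₀lt.le, h1⟩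
  exact ⟨α, ⟨ha₀.1.trans_le hα.1, hα.2⟩, hαeq⟩

/-- **`IsAlphaPlus` from a STRICT IV.3 instance**: if moreover `Z⁺_Λ < Z̃⁺(1, t)`, the tree's `IsAlphaPlus L b J r i j hij c t α` has a
solution `α ∈ (0, 1)`. -/
theorem exists_isAlphaPlus_of_lt (hL : Even L) (J : ℕ) {i j : Fin d} (hij : i < j) {c : ℕ → ℝ} (hc : CoeffAdmissible c)
    (hf : ∀ g : SU2, 0 ≤ plaqFn J c g) (hZ : 1 < torusZplus d (b * L) J c (vortexSheet (b * L) i j hij)) {r : ℝ} (hr0 : 0 ≤ r)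
    (hr1 : r ≤ 1) {t : ℝ} (ht : 0 < t)
    (hlt : torusZplus d (b * L) J c (vortexSheet (b * L) i j hij) < tildeZplus L b J r i j hij c 1 t) :
    ∃ α : ℝ, IsAlphaPlus L b J r i j hij c t α := by
  obtain ⟨α, hα, hαeq⟩ := exists_alphaPlus_Ioc hL J hij hc hf hZ hr0 hr1 ht
  have hα1 : α ≠ 1 := fun h => by rw [h] at hαeq; exact hlt.ne hαeq.symm
  exact ⟨α, ⟨hα.1, lt_of_le_of_ne hα.2 hα1⟩, hαeq⟩

end Summit.Ventures.YMGap.Census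

end
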